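import Summits.Ventures.KdS.WindowConstantsB0
import Summits.Ventures.KdS.AtlasWave1
import Literature.Geometry.Lorentzian.KerrDeSitterRealFrequencyModes
import Literature.Geometry.Lorentzian.KerrDeSitterSurfaceGravities
import HarnessLib

/-!
# Venture KdS — the box theorems on the CLOSED upper half-plane (real axis and `ω = 0` included)

HONEST FRAMING (venture `Summits/Ventures/KdS`, cell `pub-kds`, seat P1): bookkeeping plus two
elementary lemmas. The landed box theorems (`ModeStability.lean`: `msTrunc_of_facts'`;
`ModeStabilityB0.lean`/`WindowConstantsB0.lean`: `b0Theorem_of_certificates`; `AtlasWave1.lean`: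
`noMode_atlas`) concern STRICTLY GROWING modes (`Im ω > 0`) by design, although every signed census
record states its exclusion on a CLOSED rectangle `W̄(m) = [−R_m, R_m] × [−η, H]`, `η > 0`, which
contains the real segment `[−R_m, R_m]`. This file restates the same theorems for ALL `Im ω ≥ 0` —
the real axis and `ω = 0` included — from EXACTLY the same hypotheses: the cited facts
(H1) Casals–Teixeira da Costa 2022 Thm 3.10 and (H3) Prop. 3.8 (named facts of `Literature/`), the
kernel-checked window constants (H4), and the certificates' Statement B̄ (DATA, the signed records).
Nothing new is assumed and no record, table or engine changes.

Off the closed window, a REAL frequency `ω` with `|Re ω| > R_m ≥ |m|·Ω_SR` carries no mode by the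
printed REAL-AXIS bullet of (H1) ("`ω ∈ ℝ`, `λ̄ ∈ ℝ` and, if `|s| ≠ ½, 3/2`, additionally `m = 0` or
`ω/m ∉ (Ω_low, Ω_SR)`"): `λ̄ ∈ ℝ` for real `aω` is the tree's theorem `angularEigenvalue_real`
(CTdC §3.2.1), and `ω/m ∉ (Ω_low, Ω_SR)` because `|ω/m| > Ω_SR` while `Ω_low > 0`
(`superradiantLower_pos`, proved here for every subextremal Kerr–de Sitter with `a > 0`, by Vieta:
`a² + 3/Λ − (r₀ + r₁)² = 2a² + r₂² + r₂(r₀ + r₁) − r₀r₁`, over `vieta_sq` of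
`Literature/Geometry/Lorentzian/KerrDeSitterSurfaceGravities.lean`). PROVENANCE: the real-axis part
therefore rests on the SECOND printed bullet of Thm 3.10 (same named fact (H1) as the first bullet
used by the `Im ω > 0` theorems; for `|s| = 2` its printed proof invokes the Teukolsky–Starobinsky
identities, for `s = 0` Step 1 of that proof is the tree's theorem `masterRadial_zero_real_eq_zero`).
For `s = −2` the one real point excluded from (H1)'s generic-boundary regime, `ω = mϖ₂`, lies INSIDE
the closed window (`|mϖ₂| ≤ R_m`, part of (H4)), where the certificates apply (with the tree's
generic boundary bullets, as everywhere in this venture). Inside the closed window the λ-truncation is the same as before (separation constant in the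
certified set `Λs`). RESULT SHAPE: for every parameter point of the box, NO mode with `Im ω ≥ 0`,
`|m| ≤ M0`, and — when `ω` lies in the closed window — `λ ∈ Λs`; i.e. Casals–Teixeira da Costa's
Definition 3.4 window `{Im ω ≥ 0, ω ≠ 0}` (and `ω = 0`) truncated to `|m| ≤ M0` and to the certified
λ-set in-window. No claim about `|m| > M0`, about angular branches outside `Λs`, about the cited facts
themselves, or about nonlinear stability.

Contents: the thresholds `Ω_low, Ω_SR > 0` (Vieta); `not_hasMode_real_of_fact` ((H1), real-axis
bullet) and `statementAReal_of` / `statementARealZero_of`; `windowClosed`, `MSTruncClosed`,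
`msTruncClosed_of_facts'` and the scalar twins; the pilot box (`b0TheoremClosed_of_certificates`) and
the atlas (`noModeClosed_atlas`); sanity: closed ⇒ open (`msTrunc_of_closed`, `b0Theorem_of_closed`).

References: M. Casals, R. Teixeira da Costa, Commun. Math. Phys. 394 (2022) 797–832
[CasalsTeixeiradacosta2022], Def. 3.4, §3.2.1, Thm 3.10 (both bullets); cell HOME
`run/shared/lean/pub/pub-kds/` (VENTURE-STATEMENT v1.3 (S-R) "Im ω ≤ 0 and the real axis incl.
ω = 0", PLAN §1.5).
-/

noncomputable section

open Set Complex

namespace Summit.Ventures.KdS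

open Literature.Geometry.Lorentzian Literature.Geometry.Lorentzian.KerrDeSitter

/-! ### Vieta, and the two real-axis thresholds of Casals–Teixeira da Costa are positive -/

/-- `3/Λ = (r₋² + r₊² + r_c² + r₋r₊ + r₋r_c + r₊r_c) + a²` on subextremal Kerr–de Sitter (the
`r²`-Vieta relation `vieta_sq` of `KerrDeSitterSurfaceGravities.lean`, Casals–Teixeira da Costa (3.2),
solved for `3/Λ`). -/
theorem three_div_lambda_eq {M a Λ : ℝ} (hsub : IsSubextremal M a Λ) :
    3 / Λ = (rMinus M a Λ ^ 2 + rPlus M a Λ ^ 2 + rCosmo M a Λ ^ 2 + rMinus M a Λ * rPlus M a Λ +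
      rMinus M a Λ * rCosmo M a Λ + rPlus M a Λ * rCosmo M a Λ) + a ^ 2 := by
  have hv := vieta_sq hsub
  rw [div_eq_iff hsub.2.1.ne']
  linear_combination 3 * hv

/-- `Ω_low = 2a/(a² + 3/Λ − (r₀ + r₁)²) > 0` on subextremal Kerr–de Sitter with `a > 0`: by Vieta,
`a² + 3/Λ − (r₀ + r₁)² = 2a² + r₂² + r₂(r₀ + r₁) − r₀r₁ > 0` (`0 ≤ r₀ < r₁ < r₂`; Casals–Teixeira da
Costa print the sharper `ϖ₂ < Ω_low`, positivity is all that is used here). -/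
theorem superradiantLower_pos {M a Λ : ℝ} (hsub : IsSubextremal M a Λ) (ha : 0 < a) :
    0 < superradiantLower M a Λ := by
  have h3 := three_div_lambda_eq hsub
  have h0 := rMinus_nonneg M a Λ
  obtain ⟨-, -, h01, h12, -⟩ := hsub
  unfold superradiantLower
  set x := rMinus M a Λ
  set y := rPlus M a Λ
  set z := rCosmo M a Λ
  have hden : a ^ 2 + 3 / Λ - (x + y) ^ 2 = 2 * a ^ 2 + z ^ 2 + z * x + y * (z - x) := by
    rw [h3]; ring
  rw [hden]
  have hy : 0 < y := lt_of_le_of_lt h0 h01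
  have hz : 0 < z := hy.trans h12
  have h1 : 0 ≤ z * x := mul_nonneg hz.le h0
  have h2 : 0 < y * (z - x) := mul_pos hy (by linarith)
  positivity

/-- `Ω_SR = 2a/(a² + 3/Λ − (r₀ + r₂)²) > 0` on subextremal Kerr–de Sitter with `a > 0`: by Vieta,
`a² + 3/Λ − (r₀ + r₂)² = 2a² + r₁² + r₁(r₀ + r₂) − r₀r₂ > 0`. -/
theorem superradiantUpper_pos {M a Λ : ℝ} (hsub : IsSubextremal M a Λ) (ha : 0 < a) :
    0 < superradiantUpper M a Λ := by
  have h3 := three_div_lambda_eq hsub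
  have h0 := rMinus_nonneg M a Λ
  obtain ⟨-, -, h01, h12, -⟩ := hsub
  unfold superradiantUpper
  set x := rMinus M a Λ
  set y := rPlus M a Λ
  set z := rCosmo M a Λ
  have hden : a ^ 2 + 3 / Λ - (x + z) ^ 2 = 2 * a ^ 2 + y ^ 2 + y * x + z * (y - x) := by
    rw [h3]; ring
  rw [hden]
  have hy : 0 < y := lt_of_le_of_lt h0 h01
  have hz : 0 < z := hy.trans h12
  have h1 : 0 ≤ y * x := mul_nonneg hy.le h0
  have h2 : 0 < z * (y - x) := mul_pos hz (by linarith)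
  positivity

/-! ### Real frequencies: `λ̄` is real, and the real-axis bullet of (H1) -/

/-- For a REAL frequency every angular eigenvalue has real `λ̄ = λ − s(1−α) + Ξ²(2amω − a²ω²)`
(`angularEigenvalue_real`: `λ ∈ ℝ`; the shift is real for real `ω`). Casals–Teixeira da Costa 2022,
§3.2.1 ("The case `ν ∈ ℝ` … each corresponding to a real value of `λ̄`"). -/
theorem lambdaBar_im_eq_zero_of_real {a Λ s : ℝ} (hΛ : 0 ≤ Λ) {ω : ℂ} {m : ℝ} {lam : ℂ}
    (hω : ω.im = 0) (h : IsAngularEigenvalue a Λ s ω m lam) :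
    (lambdaBar a Λ s ω m lam).im = 0 := by
  have hl := angularEigenvalue_real hΛ hω h
  simp [lambdaBar, sq, Complex.mul_im, Complex.mul_re, hω, hl]

/-- **The real-axis bullet of (H1) for a genuine mode.** In the generic-boundary regime (`s ≤ 0`,
and `Re ω ≠ mϖ₂` unless `0 ≤ s`), a subextremal Kerr–de Sitter parameter point with `a > 0` carries
no spin-`s` mode at a REAL frequency `ω` with `m = 0` or `ω/m ∉ (Ω_low, Ω_SR)`: the separation
constant of a mode is an angular eigenvalue, hence `λ̄ ∈ ℝ` (`lambdaBar_im_eq_zero_of_real`), and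
Casals–Teixeira da Costa 2022 Thm 3.10 (second bullet; named fact
`CasalsTeixeiraDaCosta2022_partialModeStability`) makes the radial function vanish. -/
theorem not_hasMode_real_of_fact (h1 : CasalsTeixeiraDaCosta2022_partialModeStability)
    {M a Λ s : ℝ} {ω : ℂ} {m : ℝ} (hsub : IsSubextremal M a Λ) (ha : 0 < a) (haL : |a| < 3 / Λ)
    (haL2 : a ^ 2 < 3 / Λ) (hs : ∃ k : ℤ, 2 * s = k) (hs0 : s ≤ 0) (hk : ∃ k : ℤ, m - s = k)
    (hω : ω.im = 0)
    (hthird : m = 0 ∨ ¬(superradiantLower M a Λ < ω.re / m ∧ ω.re / m < superradiantUpper M a Λ))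
    (hray : ω.re ≠ m * horizonAngVel a (rCosmo M a Λ) ∨ 0 ≤ s) :
    ¬HasMode M a Λ s ω m := by
  rintro ⟨lam, R, hang, hrad, hin, hout, hnt⟩
  have hlamBar : (lambdaBar a Λ s ω m lam).im = 0 :=
    lambdaBar_im_eq_zero_of_real hsub.2.1.le hω hang
  have hzero := h1 M a Λ s ω m lam hsub ha.le haL haL2 hs hk
    (Or.inr ⟨hω, hlamBar, Or.inr hthird⟩) (Or.inr hs0) hray R hrad hin hout
  obtain ⟨r, hr, hne⟩ := hnt
  exact hne (hzero r hr)

/-! ### Region A on the real axis -/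

/-- Region A on the real axis: `Im ω = 0`, `|m| ≤ M0`, `|Re ω| > R_m` (off the closed window). -/
def regionPrintReal (T : WindowTable) : Set (ℂ × ℝ) :=
  {q | q.1.im = 0 ∧ |q.2| ≤ T.M0 ∧ T.R q.2 < |q.1.re|}

/-- STATEMENT A on the real axis, spin `s`: off the closed window there is no real-frequency mode. -/
def StatementAReal (B : Set (ℝ × ℝ × ℝ)) (T : WindowTable) (s : ℝ) : Prop :=
  ∀ p ∈ B, NoModeIn p.1 p.2.1 p.2.2 s (regionPrintReal T)

/-- COVERAGE on the real axis from (H1) and (H4), any box, table and spin `s ≤ 0` with `2s ∈ ℤ`: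
for `(M, a, Λ) ∈ B`, `|m| ≤ M0` and real `ω` with `|Re ω| > R_m`: `|Re ω| > R_m ≥ |m|·Ω_SR` and
`Ω_low > 0` give `ω/m ∉ (Ω_low, Ω_SR)` (or `m = 0`), and `|Re ω| > R_m ≥ |mϖ₂|` puts `ω` off the
cosmological threshold point, so the real-axis bullet of Casals–Teixeira da Costa 2022 Thm 3.10
excludes a mode (`not_hasMode_real_of_fact`). -/
theorem statementAReal_of {B : Set (ℝ × ℝ × ℝ)} {T : WindowTable} {s : ℝ}
    (h1 : CasalsTeixeiraDaCosta2022_partialModeStability) (h4 : WindowConstants B T)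
    (hs : ∃ k : ℤ, 2 * s = k) (hs0 : s ≤ 0) : StatementAReal B T s := by
  intro p hp ω m hq hk
  obtain ⟨hIm, hm2, hR⟩ := hq
  obtain ⟨hsub, hapos, haL, haL2, -, -, hconst⟩ := h4 p hp
  obtain ⟨hΩ, -, hϖ⟩ := hconst m hm2
  have hlow := superradiantLower_pos hsub hapos
  refine not_hasMode_real_of_fact h1 hsub hapos haL haL2 hs hs0 hk hIm ?_ (Or.inl ?_)
  · by_cases hm0 : m = 0
    · exact Or.inl hm0
    · refine Or.inr ?_
      rintro ⟨hlo, hhi⟩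
      have hmpos : 0 < |m| := abs_pos.mpr hm0
      have hratio : 0 < ω.re / m := hlow.trans hlo
      have habs : |ω.re| / |m| < superradiantUpper p.1 p.2.1 p.2.2 := by
        rw [← abs_div, abs_of_pos hratio]; exact hhi
      have hlt : |ω.re| < |m| * superradiantUpper p.1 p.2.1 p.2.2 :=
        lt_of_lt_of_eq ((div_lt_iff₀ hmpos).mp habs) (mul_comm _ _)
      linarith
  · intro h
    rw [h] at hR
    exact (not_lt.mpr hϖ) hR

/-- The scalar column at `m = 0`: on the WHOLE real axis (`ω = 0` included) there is no `s = 0`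
(`μ = 1`) mode, by the real-axis bullet of Casals–Teixeira da Costa 2022 Thm 3.10 with `m = 0`
(no threshold condition for `s = 0`). -/
theorem statementARealZero_of {B : Set (ℝ × ℝ × ℝ)} {T : WindowTable}
    (h1 : CasalsTeixeiraDaCosta2022_partialModeStability) (h4 : WindowConstants B T) :
    ∀ p ∈ B, NoModeIn p.1 p.2.1 p.2.2 0 {q | q.1.im = 0 ∧ q.2 = 0} := by
  intro p hp ω m hq hk
  obtain ⟨hIm, hm0⟩ := hq
  obtain ⟨hsub, hapos, haL, haL2, -⟩ := h4 p hp
  exact not_hasMode_real_of_fact h1 hsub hapos haL haL2 ⟨0, by norm_num⟩ le_rfl hk hIm (Or.inl hm0)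
    (Or.inr le_rfl)

/-! ### The closed window and MS_trunc on the closed half-plane, `s = -2` -/

/-- The CLOSED census window `W̄₀(m) = [−R_m, R_m] × [0, H]` (the window with its real edge). -/
def windowClosed (T : WindowTable) (m : ℝ) : Set ℂ := {ω | |ω.re| ≤ T.R m ∧ 0 ≤ ω.im ∧ ω.im ≤ T.H}

/-- The open-in-`Im` window lies in the closed one. -/
theorem window_subset_windowClosed (T : WindowTable) (m : ℝ) : window T m ⊆ windowClosed T m :=
  fun _ ⟨h1, h2, h3⟩ => ⟨h1, h2.le, h3⟩

/-- The closed window lies in every record rectangle `W̄(m) = [−R_m, R_m] × [−η, H]`, `η ≥ 0`. -/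
theorem windowClosed_subset_windowBar (T : WindowTable) {η : ℝ} (hη : 0 ≤ η) (m : ℝ) :
    windowClosed T m ⊆ windowBar T η m := fun _ ⟨h1, h2, h3⟩ => ⟨h1, by linarith, h3⟩

/-- The closed upper half-plane, `|m| ≤ M0`: `{(ω, m) | Im ω ≥ 0, |m| ≤ M0}` (`ω = 0` included). -/
def regionClosed (T : WindowTable) : Set (ℂ × ℝ) := {q | 0 ≤ q.1.im ∧ |q.2| ≤ T.M0}

/-- **MS_trunc on the CLOSED half-plane (`s = -2`)**: for every `(M, a, Λ) ∈ B` there is no mode with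
`Im ω ≥ 0` (real axis and `ω = 0` included), `|m| ≤ M0`, `m − s ∈ ℤ`, whose separation constant lies
in the certified set `Λs a Λ ω m` whenever `ω` is in the closed window `W̄₀(m)` (no λ-condition
off the closed window). -/
def MSTruncClosed (B : Set (ℝ × ℝ × ℝ)) (T : WindowTable) (Λs : ℝ → ℝ → ℂ → ℝ → Set ℂ) : Prop :=
  ∀ p ∈ B, NoModeWith p.1 p.2.1 p.2.2 (-2) (regionClosed T)
    (fun ω m => {lam | ω ∈ windowClosed T m → lam ∈ Λs p.2.1 p.2.2 ω m})

/-- Closed ⇒ open: `MSTruncClosed` implies the landed `MSTrunc` (same box, table, λ-family). -/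
theorem msTrunc_of_closed {B : Set (ℝ × ℝ × ℝ)} {T : WindowTable} {Λs : ℝ → ℝ → ℂ → ℝ → Set ℂ}
    (h : MSTruncClosed B T Λs) : MSTrunc B T Λs :=
  fun p hp ω m hq hk lam hlam R hR =>
    h p hp ω m ⟨hq.1.le, hq.2⟩ hk lam (fun hw => hlam ⟨hw.1, hq.1, hw.2.2⟩) R hR

/-- ASSEMBLY (`s = -2`): Statement A (off-window, `Im ω > 0`), Statement A on the real axis, and the
record wording Statement B̄ (closed rectangles, `η ≥ 0`) give MS_trunc on the closed half-plane,
provided `0 ≤ H`. -/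
theorem msTruncClosed_of {B : Set (ℝ × ℝ × ℝ)} {T : WindowTable} {η : ℝ}
    {Λs : ℝ → ℝ → ℂ → ℝ → Set ℂ} (hH : 0 ≤ T.H) (hA : StatementA B T)
    (hAr : StatementAReal B T (-2)) (hη : 0 ≤ η) (hB : StatementBbar B T η Λs) :
    MSTruncClosed B T Λs := by
  intro p hp ω m hq hk lam hlam R hR
  obtain ⟨him, hm⟩ := hq
  by_cases hw : ω ∈ windowClosed T m
  · exact hB p hp ω m ⟨hm, windowClosed_subset_windowBar T hη m hw⟩ hk lam (hlam hw) R hR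
  · rcases him.lt_or_eq with hpos | hzero
    · have hw' : ω ∉ window T m := fun h => hw (window_subset_windowClosed T m h)
      exact hA p hp ω m ⟨hpos, hm, hw'⟩ hk ⟨lam, R, hR⟩
    · have hre : T.R m < |ω.re| := by
        by_contra hle
        exact hw ⟨not_lt.mp hle, him, by rw [← hzero]; exact hH⟩
      exact hAr p hp ω m ⟨hzero.symm, hm, hre⟩ hk ⟨lam, R, hR⟩

/-- **The theorem shape on the closed half-plane, `s = -2`**: `MSTruncClosed` from (H1) Casals–Teixeira
da Costa 2022 Thm 3.10 (both printed bullets), (H3) Prop. 3.8 (threshold ray), the window constants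
(H4), and the certificates' Statement B̄ on the closed rectangles `[−R_m, R_m] × [−η, H]`, `η ≥ 0` —
exactly the hypotheses of `msTrunc_of_facts'` with Statement B̄ in place of Statement B. -/
theorem msTruncClosed_of_facts' {B : Set (ℝ × ℝ × ℝ)} {T : WindowTable} {η : ℝ}
    {Λs : ℝ → ℝ → ℂ → ℝ → Set ℂ} (h1 : CasalsTeixeiraDaCosta2022_partialModeStability)
    (h3 : CasalsTeixeiraDaCosta2022_partialModeStabilityProp38) (h4 : WindowConstants B T)
    (hη : 0 ≤ η) (hB : StatementBbar B T η Λs) : MSTruncClosed B T Λs := by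
  intro p hp
  obtain ⟨-, -, -, -, ⟨-, -, hk2, -⟩, hkap, -⟩ := h4 p hp
  have hH : 0 ≤ T.H := hk2.le.trans hkap
  exact msTruncClosed_of hH (statementA_of h1 CasalsTeixeiraDaCosta2022_angularSign_holds h3 h4)
    (statementAReal_of h1 h4 ⟨-4, by norm_num⟩ (by norm_num)) hη hB p hp

/-- Reading of `MSTruncClosed` on Casals–Teixeira da Costa's mode-stability window
`unstableWindow = {Im ω ≥ 0, ω ≠ 0}` (their Def. 3.4), truncated to `|m| ≤ M0`: no mode there with
certified separation constant in-window (and none at all off the closed window). -/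
theorem MSTruncClosed.unstableWindow {B : Set (ℝ × ℝ × ℝ)} {T : WindowTable}
    {Λs : ℝ → ℝ → ℂ → ℝ → Set ℂ} (h : MSTruncClosed B T Λs) :
    ∀ p ∈ B, NoModeWith p.1 p.2.1 p.2.2 (-2) {q | q ∈ unstableWindow ∧ |q.2| ≤ T.M0}
      (fun ω m => {lam | ω ∈ windowClosed T m → lam ∈ Λs p.2.1 p.2.2 ω m}) :=
  fun p hp ω m hq hk lam hlam R hR => h p hp ω m ⟨hq.1.1, hq.2⟩ hk lam hlam R hR

/-! ### The scalar column `s = 0`, `μ = 1` on the closed half-plane -/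

/-- The CLOSED scalar window `[−R_m, R_m] × [0, h0 m]`, `m ≠ 0` (empty for `m = 0`). -/
def windowClosedScalar (T : WindowTable) (m : ℝ) : Set ℂ :=
  {ω | m ≠ 0 ∧ |ω.re| ≤ T.R m ∧ 0 ≤ ω.im ∧ ω.im ≤ T.h0 m}

/-- The scalar window lies in the closed scalar window. -/
theorem windowScalar_subset_windowClosedScalar (T : WindowTable) (m : ℝ) :
    windowScalar T m ⊆ windowClosedScalar T m := fun _ ⟨h0, h1, h2, h3⟩ => ⟨h0, h1, h2.le, h3⟩

/-- The closed scalar window lies in every scalar record rectangle, `η ≥ 0`. -/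
theorem windowClosedScalar_subset_windowBarScalar (T : WindowTable) {η : ℝ} (hη : 0 ≤ η) (m : ℝ) :
    windowClosedScalar T m ⊆ windowBarScalar T η m :=
  fun _ ⟨h0, h1, h2, h3⟩ => ⟨h0, h1, by linarith, h3⟩

/-- **MS_trunc on the CLOSED half-plane, scalar column (`s = 0`, `μ = 1`)**: for every
`(M, a, Λ) ∈ B`, no mode with `Im ω ≥ 0` (real axis and `ω = 0` included), `|m| ≤ M0`, `m ∈ ℤ`,
whose separation constant lies in `Λs a Λ ω m` whenever `ω` is in the closed scalar window. -/
def MSTruncClosedScalar (B : Set (ℝ × ℝ × ℝ)) (T : WindowTable)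
    (Λs : ℝ → ℝ → ℂ → ℝ → Set ℂ) : Prop :=
  ∀ p ∈ B, NoModeWith p.1 p.2.1 p.2.2 0 (regionClosed T)
    (fun ω m => {lam | ω ∈ windowClosedScalar T m → lam ∈ Λs p.2.1 p.2.2 ω m})

/-- Closed ⇒ open, scalar column. -/
theorem msTruncScalar_of_closed {B : Set (ℝ × ℝ × ℝ)} {T : WindowTable}
    {Λs : ℝ → ℝ → ℂ → ℝ → Set ℂ} (h : MSTruncClosedScalar B T Λs) : MSTruncScalar B T Λs :=
  fun p hp ω m hq hk lam hlam R hR =>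
    h p hp ω m ⟨hq.1.le, hq.2⟩ hk lam (fun hw => hlam ⟨hw.1, hw.2.1, hq.1, hw.2.2.2⟩) R hR

/-- **The theorem shape on the closed half-plane, scalar column**: `MSTruncClosedScalar` from (H1)
(both printed bullets), (H4), (H4s) and the scalar certificates' Statement B̄ (`η ≥ 0`) — exactly the
hypotheses of `msTruncScalar_of_facts'` with Statement B̄ in place of Statement B. Off the closed
scalar window a real frequency is excluded by the real-axis bullet (`m ≠ 0`: `|Re ω| > R_m`;
`m = 0`: every real `ω`, `statementARealZero_of`). -/
theorem msTruncClosedScalar_of_facts' {B : Set (ℝ × ℝ × ℝ)} {T : WindowTable} {η : ℝ}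
    {Λs : ℝ → ℝ → ℂ → ℝ → Set ℂ} (h1 : CasalsTeixeiraDaCosta2022_partialModeStability)
    (h4 : WindowConstants B T) (h4s : WindowConstantsScalar B T) (hη : 0 ≤ η)
    (hB : StatementBbarScalar B T η Λs) : MSTruncClosedScalar B T Λs := by
  have hA := statementAScalar_of h1 CasalsTeixeiraDaCosta2022_angularSign_holds h4 h4s
  have hAr := statementAReal_of (s := 0) h1 h4 ⟨0, by norm_num⟩ le_rfl
  have hA0 := statementARealZero_of h1 h4
  intro p hp ω m hq hk lam hlam R hR
  obtain ⟨him, hm⟩ := hq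
  by_cases hw : ω ∈ windowClosedScalar T m
  · exact hB p hp ω m ⟨hm, windowClosedScalar_subset_windowBarScalar T hη m hw⟩ hk lam (hlam hw) R hR
  · rcases him.lt_or_eq with hpos | hzero
    · have hw' : ω ∉ windowScalar T m := fun h => hw (windowScalar_subset_windowClosedScalar T m h)
      exact hA p hp ω m ⟨hpos, hm, hw'⟩ hk ⟨lam, R, hR⟩
    · by_cases hm0 : m = 0
      · exact hA0 p hp ω m ⟨hzero.symm, hm0⟩ hk ⟨lam, R, hR⟩
      · obtain ⟨hsub, hapos, -⟩ := h4 p hp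
        have hh0 : 0 ≤ T.h0 m :=
          (mul_pos (abs_pos.mpr hm0) (superradiantUpper_pos hsub hapos)).le.trans (h4s p hp m hm hm0)
        have hre : T.R m < |ω.re| := by
          by_contra hle
          exact hw ⟨hm0, not_lt.mp hle, him, by rw [← hzero]; exact hh0⟩
        exact hAr p hp ω m ⟨hzero.symm, hm, hre⟩ hk ⟨lam, R, hR⟩

/-! ### The pilot box `B0` -/

/-- THE B0 BOX THEOREM ON THE CLOSED HALF-PLANE (`s = -2` and `s = 0`, `μ = 1`; `|m| ≤ 2`;
`Im ω ≥ 0` incl. the real axis and `ω = 0`; λ in eng-3's rectangles inside the closed windows). -/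
def B0TheoremClosed : Prop :=
  MSTruncClosed B0 tableB0 rectB0 ∧ MSTruncClosedScalar B0 tableB0 rectB0Scalar

/-- Closed ⇒ open: the closed-half-plane B0 theorem implies the landed `B0Theorem`. -/
theorem b0Theorem_of_closed (h : B0TheoremClosed) : B0Theorem :=
  ⟨msTrunc_of_closed h.1, msTruncScalar_of_closed h.2⟩

/-- PROVED GLUE: the closed-half-plane B0 theorem from the cited facts (H1), (H3), rung R2 and rung R3
— the SAME hypotheses as `b0Theorem_of'` (R3 is Statement B̄ with `η = 1/125`). -/
theorem b0TheoremClosed_of' (h1 : CasalsTeixeiraDaCosta2022_partialModeStability)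
    (h3 : CasalsTeixeiraDaCosta2022_partialModeStabilityProp38)
    (hR2 : R2_WindowConstantsB0) (hR3 : R3_B0Certificates) : B0TheoremClosed :=
  ⟨msTruncClosed_of_facts' h1 h3 hR2.1 (by norm_num) hR3.1,
    msTruncClosedScalar_of_facts' h1 hR2.1 hR2.2 (by norm_num) hR3.2⟩

/-- **THE CLOSED-HALF-PLANE B0 THEOREM FROM THE CERTIFICATES**: with (H2) and rung R2 proved in the
tree (`CasalsTeixeiraDaCosta2022_angularSign_holds`, `r2_windowConstantsB0`), `B0TheoremClosed`
follows from the two cited facts (H1), (H3) and the signed certificates R3 alone — the same three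
hypotheses as `b0Theorem_of_certificates`. -/
theorem b0TheoremClosed_of_certificates (h1 : CasalsTeixeiraDaCosta2022_partialModeStability)
    (h3 : CasalsTeixeiraDaCosta2022_partialModeStabilityProp38) (hR3 : R3_B0Certificates) :
    B0TheoremClosed :=
  b0TheoremClosed_of' h1 h3 r2_windowConstantsB0 hR3

/-! ### The atlas (a wave = a list of certified tiles) -/

section Wave

variable {ts : List CertTile}

/-- **MS_trunc on the closed half-plane (`s = -2`) on every tile of the wave**, from (H1), (H3), the
kernel-checked window constants and the DATA binders — the same hypotheses as `msTrunc_atlas`. -/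
theorem msTruncClosed_atlas (hWC : ∀ t ∈ ts, WindowConstants t.tile.box t.T)
    (hη : ∀ t ∈ ts, 0 ≤ t.eta) (h1 : CasalsTeixeiraDaCosta2022_partialModeStability)
    (h3 : CasalsTeixeiraDaCosta2022_partialModeStabilityProp38) (hdata : ∀ t ∈ ts, t.Data) :
    ∀ t ∈ ts, MSTruncClosed t.tile.box t.T t.lam :=
  fun t ht => msTruncClosed_of_facts' h1 h3 (hWC t ht) (hη t ht) (t.statementBbar (hdata t ht))

/-- **Scalar MS_trunc on the closed half-plane on every tile**, from (H1), (H4), (H4s) and the scalar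
DATA — the same hypotheses as `msTruncScalar_atlas`. -/
theorem msTruncClosedScalar_atlas (hWC : ∀ t ∈ ts, WindowConstants t.tile.box t.T)
    (hWCs : ∀ t ∈ ts, WindowConstantsScalar t.tile.box t.T) (hη : ∀ t ∈ ts, 0 ≤ t.eta)
    (h1 : CasalsTeixeiraDaCosta2022_partialModeStability) (hdata : ∀ t ∈ ts, t.DataScalar) :
    ∀ t ∈ ts, MSTruncClosedScalar t.tile.box t.T t.lamScalar :=
  fun t ht => msTruncClosedScalar_of_facts' h1 (hWC t ht) (hWCs t ht) (hη t ht)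
    (t.statementBbarScalar (hdata t ht))

/-- **The displayed wave theorem on the closed half-plane, pointwise form (`s = -2`).** For every
parameter point of the atlas there is a tile of the list containing it on which: there is NO mode
with `Im ω ≥ 0` (the real axis and `ω = 0` included) and `|m| ≤ 2` whose separation constant lies in
the tile's (symmetrised) λ-family when `ω` is in the tile's closed window `W̄₀(m)` — and no such mode
at all when `ω` is outside it — given (H1), (H3), the kernel-checked window constants and the
certificates' DATA (the same hypotheses as `noMode_atlas`). -/
theorem noModeClosed_atlas (hWC : ∀ t ∈ ts, WindowConstants t.tile.box t.T)
    (hη : ∀ t ∈ ts, 0 ≤ t.eta) (h1 : CasalsTeixeiraDaCosta2022_partialModeStability)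
    (h3 : CasalsTeixeiraDaCosta2022_partialModeStabilityProp38) (hdata : ∀ t ∈ ts, t.Data) :
    ∀ p ∈ atlas ts, ∃ t ∈ ts, p ∈ t.tile.box ∧
      NoModeWith p.1 p.2.1 p.2.2 (-2) {q | 0 ≤ q.1.im ∧ |q.2| ≤ 2}
        (fun ω m => {lam | ω ∈ windowClosed t.T m → lam ∈ t.lam p.2.1 p.2.2 ω m}) := by
  rintro p ⟨t, ht, hp⟩
  exact ⟨t, ht, hp, msTruncClosed_atlas hWC hη h1 h3 hdata t ht p hp⟩

end Wave

end Summit.Ventures.KdS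

end
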